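import Summits.Schanuel.Schanuel.Theorems.ZilberEacSuperellipticPolyFibres
import HarnessLib

/-!
# Arbitrary base branches, XL: MIXED polynomial fibres `y₀ = R(x₀, x₁)` over `x₁^k = P(x₀)` with a
# unique monomial of maximal weight — case ∧ dense

HONEST FRAMING.  Cell `pub-schanuel` (Zilber's Exponential-Algebraic Closedness, case ladder;
host summit Schanuel), seat 2, gen 29.  File XXXVII decided the fibres `y₀ = R(x₀)` and
`y₀ = R(x₁)`.  For a polynomial `R(x₀, x₁)` in BOTH coordinates, along a sheet `x₀ = s^{-k}`,
`x₁ = Φ(s)s^{-M}` (`M = deg P`, `Φ(0) = ζ`) the monomial `x₀^i x₁^j` has a pole of WEIGHT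
`ki + Mj`; if `R` has a UNIQUE monomial `x₀^a x₁^b ≠ 1` of maximal weight `L*`, then
`R = ψ(s)s^{-L*}` with `ψ(0) = c_{ab}ζ^b ≠ 0` on every sheet — a pole fibre value, and the
dispatcher of file XXXVII applies: **`unprojectedDensityQuestion_superelliptic_mixedFibre`** —
`{x₁^k − P(x₀) = 0, y₀ = R(x₀, x₁)}` is in Mantova–Masser's case AND dense (`k ≥ 2`, `P` monic of
degree `M ≥ 1` with a simple root, `M ≠ k ∨ k ≥ 3`).  When several monomials share the top weight
their leading coefficients `Σ c_{ij}ζ^j` may cancel on a sheet (e.g. `R = x₁^k − P(x₀)` vanishes on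
`C`): not treated.  Decided instances of an OPEN question (Mantova–Masser, PLMS 2024 §1 p. 5);
EC(3,2) OPEN; NOT Schanuel's conjecture (neither used nor implied); EAC ⇏ SC.
-/

noncomputable section

open Filter Topology Set Complex MvPolynomial
open Literature.NumberTheory.Transcendental Literature.ModelTheory.Zilber
open Literature.ModelTheory.ExponentialFields

set_option linter.dupNamespace false

namespace Summit.Schanuel.Schanuel.Theorems

section Superelliptic

variable (P : Polynomial ℂ)

/-- **The fibre value along a sheet** for `R` with a unique monomial `a` of maximal
`(k, M)`-weight: `R(s^{-k}, Φ(s)s^{-M}) = ψ(s)·s^{-(k a₀ + M a₁)}` for small `s ≠ 0`, with `ψ`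
analytic at `0` and `ψ(0) = R_a·Φ(0)^{a₁}`. [folklore] -/
theorem mixedFibre_sheet_value (R : MvPolynomial (Fin 2) ℂ) {k M : ℕ} {Φ : ℂ → ℂ}
    (hΦ : AnalyticAt ℂ Φ 0) {a : Fin 2 →₀ ℕ} (ha : a ∈ R.support)
    (hmax : ∀ m ∈ R.support, m ≠ a → k * m 0 + M * m 1 < k * a 0 + M * a 1) :
    ∃ ψ : ℂ → ℂ, AnalyticAt ℂ ψ 0 ∧ ψ 0 = R.coeff a * Φ 0 ^ (a 1) ∧
      ∀ s : ℂ, s ≠ 0 → MvPolynomial.eval ![(s ^ k)⁻¹, Φ s * (s ^ M)⁻¹] R =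
        ψ s * s ^ (-((k * a 0 + M * a 1 : ℕ) : ℤ)) := by
  classical
  set L : ℕ := k * a 0 + M * a 1 with hL
  set ψ : ℂ → ℂ := fun s => ∑ m ∈ R.support, R.coeff m * Φ s ^ (m 1) * s ^ (L - (k * m 0 + M * m 1))
    with hψ
  have hle : ∀ m ∈ R.support, k * m 0 + M * m 1 ≤ L := by
    intro m hm
    by_cases hma : m = a
    · rw [hma]
    · exact (hmax m hm hma).le
  refine ⟨ψ, ?_, ?_, ?_⟩
  · exact Finset.analyticAt_fun_sum _ fun m _ =>
      (analyticAt_const.mul (hΦ.pow _)).mul (analyticAt_id.pow _)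
  · rw [hψ]
    simp only
    rw [Finset.sum_eq_single_of_mem a ha]
    · rw [hL, Nat.sub_self, pow_zero, mul_one]
    · intro m hm hma
      have hpos : L - (k * m 0 + M * m 1) ≠ 0 := by have := hmax m hm hma; omega
      rw [zero_pow hpos, mul_zero]
  · intro s hs
    rw [MvPolynomial.eval_eq', hψ]
    simp only [Fin.prod_univ_two, Matrix.cons_val_zero, Matrix.cons_val_one]
    rw [Finset.sum_mul]
    refine Finset.sum_congr rfl fun m hm => ?_
    have hw := hle m hm
    rw [zpow_neg, zpow_natCast, mul_pow, inv_pow, inv_pow, ← pow_mul, ← pow_mul]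
    have hsplit : s ^ L = s ^ (k * m 0) * s ^ (M * m 1) * s ^ (L - (k * m 0 + M * m 1)) := by
      rw [← pow_add, ← pow_add]
      congr 1
      omega
    rw [hsplit]
    field_simp

/-- **Mixed polynomial fibres with a unique monomial of maximal weight: dense.**  `k ≥ 1`, `P`
monic of degree `M ≥ 1` with a simple root, `M ≠ k ∨ k ≥ 3`; `R ∈ ℂ[x₀, x₁]` with a unique
monomial `a ≠ 0` of maximal weight `k a₀ + M a₁`.  Then `{x₁^k − P(x₀) = 0, y₀ = R(x₀, x₁)}` has
Zariski-dense exponential points. [cite: MantovaMasser2023, §1 Further remarks, p. 5 (the question,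
open in general)] (new) -/
theorem unprojectedDense_superelliptic_mixedFibre (R : MvPolynomial (Fin 2) ℂ) {k : ℕ} (hk : 1 ≤ k)
    (hP : P.Monic) (hM : 1 ≤ P.natDegree) {r : ℂ} (hr : P.IsRoot r) (hr1 : P.derivative.eval r ≠ 0)
    (hexc : P.natDegree ≠ k ∨ 3 ≤ k) {a : Fin 2 →₀ ℕ} (ha : a ∈ R.support) (ha0 : a ≠ 0)
    (hmax : ∀ m ∈ R.support, m ≠ a → k * m 0 + P.natDegree * m 1 < k * a 0 + P.natDegree * a 1) :
    UnprojectedDense {w : Fin 2 ⊕ Fin 2 → ℂ |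
      MvPolynomial.eval ![w (Sum.inl 0), w (Sum.inl 1)]
          (X 1 ^ k - Polynomial.aeval (X 0 : MvPolynomial (Fin 2) ℂ) P) = 0 ∧
      w (Sum.inr 0) = MvPolynomial.eval ![w (Sum.inl 0), w (Sum.inl 1)] R} := by
  have hS := isIrreducibleClosed_curveGraphFibre R (irreducible_superellipticMv P hk hr hr1)
  have hdim := zariskiDim_curveGraphFibre R (irreducible_superellipticMv P hk hr hr1)
  have hLpos : 0 < k * a 0 + P.natDegree * a 1 := by
    have : a 0 ≠ 0 ∨ a 1 ≠ 0 := by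
      by_contra h
      push Not at h
      apply ha0
      ext i
      fin_cases i
      · exact h.1
      · exact h.2
    rcases this with h | h
    · have : 0 < k * a 0 := Nat.mul_pos hk (Nat.pos_of_ne_zero h)
      omega
    · have : 0 < P.natDegree * a 1 := Nat.mul_pos hM (Nat.pos_of_ne_zero h)
      omega
  refine unprojectedDense_superelliptic_of_sheets P hS (le_of_eq hdim) hk hP hM hexc ?_
  intro ζ Φ hζ hΦan hΦ0 hsheet
  have hζ0 : ζ ≠ 0 := by
    rintro rfl
    rw [zero_pow (by omega)] at hζ
    exact zero_ne_one hζ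
  obtain ⟨ψ, hψan, hψ0, hval⟩ := mixedFibre_sheet_value R hΦan ha hmax (k := k) (M := P.natDegree)
  refine ⟨ψ, -((k * a 0 + P.natDegree * a 1 : ℕ) : ℤ), hψan, ?_, ?_, ?_⟩
  · rw [hψ0, hΦ0]
    exact mul_ne_zero (MvPolynomial.mem_support_iff.1 ha) (pow_ne_zero _ hζ0)
  · rw [neg_ne_zero, Nat.cast_ne_zero]
    omega
  · filter_upwards [hsheet, self_mem_nhdsWithin] with s hs (hs0 : s ≠ 0)
    refine ⟨?_, ?_⟩
    · simp only [Sum.elim_inl, Matrix.cons_val_zero, Matrix.cons_val_one]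
      rw [eval_superellipticMv]
      simpa only [Matrix.cons_val_zero, Matrix.cons_val_one] using hs
    · simp only [Sum.elim_inr, Sum.elim_inl, Matrix.cons_val_zero, Matrix.cons_val_one]
      exact (hval s hs0).symm

/-- **Mantova–Masser's question for `{x₁^k − P(x₀) = 0, y₀ = R(x₀, x₁)}` with a unique top-weight
monomial: case ∧ dense** (`k ≥ 2`; hypotheses as above), in plain coordinates.
[cite: MantovaMasser2023, §1 Further remarks, p. 5 (the question, open in general)] (new) -/
theorem unprojectedDensityQuestion_superelliptic_mixedFibre (R : MvPolynomial (Fin 2) ℂ) {k : ℕ}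
    (hk : 2 ≤ k) (hP : P.Monic) (hM : 1 ≤ P.natDegree) {r : ℂ} (hr : P.IsRoot r)
    (hr1 : P.derivative.eval r ≠ 0) (hexc : P.natDegree ≠ k ∨ 3 ≤ k) {a : Fin 2 →₀ ℕ}
    (ha : a ∈ R.support) (ha0 : a ≠ 0)
    (hmax : ∀ m ∈ R.support, m ≠ a → k * m 0 + P.natDegree * m 1 < k * a 0 + P.natDegree * a 1) :
    MMCaseDimPiOneFree {w : Fin 2 ⊕ Fin 2 → ℂ |
        w (Sum.inl 1) ^ k - P.eval (w (Sum.inl 0)) = 0 ∧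
        w (Sum.inr 0) = MvPolynomial.eval ![w (Sum.inl 0), w (Sum.inl 1)] R} ∧
      UnprojectedDense {w : Fin 2 ⊕ Fin 2 → ℂ |
        w (Sum.inl 1) ^ k - P.eval (w (Sum.inl 0)) = 0 ∧
        w (Sum.inr 0) = MvPolynomial.eval ![w (Sum.inl 0), w (Sum.inl 1)] R} := by
  have hk1 : 1 ≤ k := by omega
  have hP0 : P ≠ 0 := by
    rintro rfl
    simp at hr1
  -- a point of `C` with `R ≠ 0`: along the principal sheet `R = ψ(s)s^{-L*}` with `ψ(0) ≠ 0`
  have hcase : MMCaseDimPiOneFree {w : Fin 2 ⊕ Fin 2 → ℂ |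
      MvPolynomial.eval ![w (Sum.inl 0), w (Sum.inl 1)]
          (X 1 ^ k - Polynomial.aeval (X 0 : MvPolynomial (Fin 2) ℂ) P) = 0 ∧
      w (Sum.inr 0) = MvPolynomial.eval ![w (Sum.inl 0), w (Sum.inl 1)] R} := by
    refine mmCase_curveGraphFibre (irreducible_superellipticMv P hk1 hr hr1) ?_
      (superelliptic_not_on_line P hk hP0)
    obtain ⟨Φ, hΦan, hΦ0, hsheet⟩ := superelliptic_sheet_facts P hk1 hP (one_pow k)
    obtain ⟨ψ, hψan, hψ0, hval⟩ := mixedFibre_sheet_value R hΦan ha hmax (k := k) (M := P.natDegree)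
    have hψne : ∀ᶠ s in 𝓝 (0 : ℂ), ψ s ≠ 0 := hψan.continuousAt.eventually_ne (by
      rw [hψ0, hΦ0, one_pow, mul_one]
      exact MvPolynomial.mem_support_iff.1 ha)
    have hψne' : ∀ᶠ s in 𝓝[≠] (0 : ℂ), ψ s ≠ 0 := nhdsWithin_le_nhds hψne
    have hne0 : ∀ᶠ s in 𝓝[≠] (0 : ℂ), s ≠ 0 := self_mem_nhdsWithin
    obtain ⟨s, hs, hψs, hs0⟩ := (hsheet.and (hψne'.and hne0)).exists
    refine ⟨![(s ^ k)⁻¹, Φ s * (s ^ P.natDegree)⁻¹], ?_, ?_⟩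
    · rw [eval_superellipticMv]
      simpa only [Matrix.cons_val_zero, Matrix.cons_val_one] using hs
    · rw [hval s hs0]
      exact mul_ne_zero hψs (zpow_ne_zero _ hs0)
  have e : {w : Fin 2 ⊕ Fin 2 → ℂ |
        MvPolynomial.eval ![w (Sum.inl 0), w (Sum.inl 1)]
            (X 1 ^ k - Polynomial.aeval (X 0 : MvPolynomial (Fin 2) ℂ) P) = 0 ∧
        w (Sum.inr 0) = MvPolynomial.eval ![w (Sum.inl 0), w (Sum.inl 1)] R} =
      {w : Fin 2 ⊕ Fin 2 → ℂ |
        w (Sum.inl 1) ^ k - P.eval (w (Sum.inl 0)) = 0 ∧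
        w (Sum.inr 0) = MvPolynomial.eval ![w (Sum.inl 0), w (Sum.inl 1)] R} := by
    ext w
    simp only [Set.mem_setOf_eq, eval_superellipticMv, Matrix.cons_val_zero, Matrix.cons_val_one]
  have h : MMCaseDimPiOneFree _ ∧ UnprojectedDense _ :=
    ⟨hcase, unprojectedDense_superelliptic_mixedFibre P R hk1 hP hM hr hr1 hexc ha ha0 hmax⟩
  rw [e] at h
  exact h

/-- Example: `{x₁³ = x₀² + 1, y₀ = x₀x₁}` — the monomial `x₀x₁` (weight `3 + 2 = 5`) is the unique
top-weight monomial; `(k, M) = (3, 2)`.  Case ∧ dense. [cite: MantovaMasser2023, §1 Further remarks,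
p. 5 (the question, open in general)] (new) -/
theorem unprojectedDensityQuestion_slowCusp_fibre_x₀x₁ :
    MMCaseDimPiOneFree {w : Fin 2 ⊕ Fin 2 → ℂ |
        w (Sum.inl 1) ^ 3 - (Polynomial.X ^ 2 + 1 : Polynomial ℂ).eval (w (Sum.inl 0)) = 0 ∧
        w (Sum.inr 0) = MvPolynomial.eval ![w (Sum.inl 0), w (Sum.inl 1)]
          (X 0 * X 1 : MvPolynomial (Fin 2) ℂ)} ∧
      UnprojectedDense {w : Fin 2 ⊕ Fin 2 → ℂ |
        w (Sum.inl 1) ^ 3 - (Polynomial.X ^ 2 + 1 : Polynomial ℂ).eval (w (Sum.inl 0)) = 0 ∧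
        w (Sum.inr 0) = MvPolynomial.eval ![w (Sum.inl 0), w (Sum.inl 1)]
          (X 0 * X 1 : MvPolynomial (Fin 2) ℂ)} := by
  classical
  have hmonic : (Polynomial.X ^ 2 + 1 : Polynomial ℂ).Monic := by
    simpa using Polynomial.monic_X_pow_add_C (1 : ℂ) (by norm_num : (2 : ℕ) ≠ 0)
  have hdeg : (Polynomial.X ^ 2 + 1 : Polynomial ℂ).natDegree = 2 := by
    simpa using Polynomial.natDegree_X_pow_add_C (n := 2) (r := (1 : ℂ))
  have hroot : (Polynomial.X ^ 2 + 1 : Polynomial ℂ).IsRoot I := by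
    simp [Polynomial.IsRoot, Complex.I_sq]
  have hder : (Polynomial.derivative (Polynomial.X ^ 2 + 1 : Polynomial ℂ)).eval I ≠ 0 := by
    rw [Polynomial.derivative_add, Polynomial.derivative_one, Polynomial.derivative_X_pow, add_zero,
      Polynomial.eval_mul, Polynomial.eval_C, Polynomial.eval_pow, Polynomial.eval_X]
    simp [Complex.I_ne_zero]
  -- the monomial `x₀ x₁`
  have hmono : (X 0 * X 1 : MvPolynomial (Fin 2) ℂ) =
      MvPolynomial.monomial (Finsupp.single 0 1 + Finsupp.single 1 1) 1 := by
    rw [MvPolynomial.X, MvPolynomial.X, MvPolynomial.monomial_mul, mul_one]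
  have hsupp : (X 0 * X 1 : MvPolynomial (Fin 2) ℂ).support =
      {Finsupp.single 0 1 + Finsupp.single 1 1} := by
    rw [hmono, MvPolynomial.support_monomial, if_neg one_ne_zero]
  refine unprojectedDensityQuestion_superelliptic_mixedFibre _ (X 0 * X 1) (by norm_num) hmonic
    (by omega) hroot hder (Or.inr le_rfl) (a := Finsupp.single 0 1 + Finsupp.single 1 1)
    (by rw [hsupp]; exact Finset.mem_singleton_self _) ?_ ?_
  · intro h
    have := Finsupp.ext_iff.1 h 0
    simp at this
  · intro m hm hma
    rw [hsupp, Finset.mem_singleton] at hm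
    exact absurd hm hma

end Superelliptic

end Summit.Schanuel.Schanuel.Theorems

end
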